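import Summits.ValiantsHypothesis.ValiantsHypothesis.Theorems.BarrierLeverKFoldDetCapacityBound
import Summits.ValiantsHypothesis.ValiantsHypothesis.Theorems.BarrierLeverUniversalCertificateCapacityBarrier
import Summits.ValiantsHypothesis.ValiantsHypothesis.Theorems.BarrierLeverDiagonalPencilCoeff

/-!
# Route BarrierLever — item `PartitionMinorsHitByVP` (stmt-ValiantsHypothesis-19717):
# NO-GO for determinantal witnesses of BOUNDED MULTIPLICITY

Helper file (`--supports stmt-ValiantsHypothesis-19717`; cell valiant-natproofs, rung V4, 𝒟-side door
(c); prover seat val-np-p6 gen 7). Definition-free; cone-free (pure linear algebra + `MvPolynomial`).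

The `K`-FOLD DETERMINANTAL WITNESS of a table `G ∈ ℂ^{N×N}` and a labelling `π : Fin N → Fin (h+h)` is
`f_{G,π} = det(1 + diag(X_{π 0}, …, X_{π (N-1)}) · G) = rename π (det(1 + diag(X) · G)) ∈ ℂ[x, y]`
— every determinantal witness `det(C + Σ_v X_v A_v)` with `C` invertible and `rank A_v ≤ K` is of this
form with fibres `|π⁻¹(v)| ≤ K` (`det(1 + PQᵀ) = det(1 + QᵀP)`); `K = 1`, `π = id` is the principal-minor
witness of TNS (item 19126), the bi-affine determinant of `…TransversalMinorDoor` has `K = h`.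

* `coeff_kfoldWitness` — its partition coefficients are the `K`-fold principal-minor sums
  `[x^U y^W] f_{G,π} = Σ_{R : π(R) = U ⊔ W̄ bijectively} det G[R, R]` (val-np-p1's generating identity
  `DiagonalPencil.det_one_add_diagonal_mul` pushed through `rename π`; `indicatorSum_eq_iff`).
* **`kfoldWitness_dead_layout`** — if `(K|T|)² + 1 < 2^|T| ≤ h + 1` for some block `T ⊆ Fin h`, ONE
  injective layout (`2^|T|` rows of size `≤ 1`, the subsets of `T` as columns) has a SINGULAR layout
  matrix for EVERY `N`, `G` and every labelling with at most `K` indices on each label `ȳ_c`, `c ∈ T`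
  (`KFoldDet.kfold_det_eq_zero_of_singleton_rows` + `CapacityBarrier.exists_injective_layout`).
  Reading: a determinantal witness template for item 19717 must give some variable multiplicity
  `K` with `(K ⌈log₂(h+1)⌉)² + 1 ≥ h + 1`, i.e. `K ≳ √h / log₂ h`.

WHAT THIS IS NOT: nothing about item 19717 itself (its witnesses may depend on the layout, and these
layouts are hit by `SmallLayouts.partitionMinor_hit_of_card_le`); nothing on crux
stmt-ValiantsHypothesis-14610 or `VP ≠ VNP`.
-/

set_option linter.dupNamespace false

open Matrix Finset MvPolynomial

namespace Summit.ValiantsHypothesis.ValiantsHypothesis.Theorems.BarrierLever.KFoldDet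

open Summit.ValiantsHypothesis.ValiantsHypothesis.Theorems.BarrierLever.DiagonalPencil
  (det_one_add_diagonal_mul)
open Summit.ValiantsHypothesis.ValiantsHypothesis.Theorems.BarrierLever.CapacityBarrier
  (exists_injective_layout succ_le_card_filter_card_le_one eq_empty_or_singleton_of_card_le_one)

noncomputable section

/-! ## 1. The partition coefficients of a `K`-fold determinantal witness -/

/-- Pointwise value of a sum of unit vectors: the fibre count. -/
theorem indicatorSum_apply {N m : ℕ} (π : Fin N → Fin m) (R : Finset (Fin N)) (v : Fin m) :
    (∑ j ∈ R, Finsupp.single (π j) 1 : Fin m →₀ ℕ) v = (R.filter (fun j => π j = v)).card := by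
  classical
  rw [Finsupp.finsetSum_apply]
  simp_rw [Finsupp.single_apply]
  rw [Finset.card_filter]

/-- `Σ_{j ∈ R} e_{π j} = 𝟙_L` exactly when `π` maps `R` bijectively onto `L`. -/
theorem indicatorSum_eq_iff {N m : ℕ} (π : Fin N → Fin m) (R : Finset (Fin N)) (L : Finset (Fin m)) :
    (∑ j ∈ R, Finsupp.single (π j) 1 : Fin m →₀ ℕ) = ∑ v ∈ L, Finsupp.single v 1 ↔
      R.image π = L ∧ R.card = L.card := by
  classical
  have hLv : ∀ v, (∑ v' ∈ L, Finsupp.single v' 1 : Fin m →₀ ℕ) v = if v ∈ L then 1 else 0 := by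
    intro v
    rw [Finsupp.finsetSum_apply]
    simp_rw [Finsupp.single_apply]
    rw [Finset.sum_ite_eq' L v]
  -- `|R| = Σ_v (fibre counts)`
  have hcardR : R.card = ∑ v ∈ R.image π, (R.filter (fun j => π j = v)).card :=
    Finset.card_eq_sum_card_image π R
  constructor
  · intro heq
    have hfib : ∀ v, (R.filter (fun j => π j = v)).card = if v ∈ L then 1 else 0 := by
      intro v
      have := congrArg (fun f : Fin m →₀ ℕ => f v) heq
      simp only [indicatorSum_apply, hLv] at this
      exact this
    have himg : R.image π = L := by
      ext v
      rw [Finset.mem_image]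
      constructor
      · rintro ⟨j, hj, rfl⟩
        by_contra hv
        have h0 := hfib (π j)
        rw [if_neg hv, Finset.card_eq_zero, Finset.filter_eq_empty_iff] at h0
        exact h0 hj rfl
      · intro hv
        have h1 := hfib v
        rw [if_pos hv] at h1
        obtain ⟨j, hj⟩ := Finset.card_pos.mp (by rw [h1]; exact Nat.one_pos)
        rw [Finset.mem_filter] at hj
        exact ⟨j, hj.1, hj.2⟩
    refine ⟨himg, ?_⟩
    rw [hcardR, himg]
    rw [Finset.sum_congr rfl fun v hv => by rw [hfib v, if_pos hv]]
    simp
  · rintro ⟨himg, hcard⟩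
    have hinj : Set.InjOn π (R : Set (Fin N)) := by
      rw [← Finset.card_image_iff, himg, hcard]
    ext v
    rw [indicatorSum_apply, hLv]
    by_cases hv : v ∈ L
    · rw [if_pos hv]
      rw [← himg, Finset.mem_image] at hv
      obtain ⟨j, hj, rfl⟩ := hv
      apply le_antisymm
      · rw [Finset.card_le_one]
        intro a ha b hb
        rw [Finset.mem_filter] at ha hb
        exact hinj ha.1 hb.1 (ha.2.trans hb.2.symm)
      · exact Finset.card_pos.mpr ⟨j, Finset.mem_filter.mpr ⟨hj, rfl⟩⟩
    · rw [if_neg hv, Finset.card_eq_zero, Finset.filter_eq_empty_iff]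
      intro j hj hjv
      apply hv
      rw [← himg, ← hjv]
      exact Finset.mem_image_of_mem π hj

variable {h : ℕ}

/-- The partition exponent of `x^U y^W` is the indicator of the label set `U ⊔ W̄`. -/
theorem partitionExpo_eq_indicator (U W : Finset (Fin h)) :
    (∑ a ∈ U, Finsupp.single (Fin.castAdd h a) 1 + ∑ c ∈ W, Finsupp.single (Fin.natAdd h c) 1 :
      Fin (h + h) →₀ ℕ) =
      ∑ v ∈ U.map (Fin.castAddEmb h) ∪ W.map (Fin.natAddEmb h), Finsupp.single v 1 := by
  have hdisj : Disjoint (U.map (Fin.castAddEmb h)) (W.map (Fin.natAddEmb h)) := by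
    rw [Finset.disjoint_left]
    intro v hvU hvW
    obtain ⟨a, -, rfl⟩ := Finset.mem_map.mp hvU
    obtain ⟨c, -, hc⟩ := Finset.mem_map.mp hvW
    have := congrArg Fin.val hc
    simp only [Fin.natAddEmb_apply, Fin.val_natAdd, Fin.castAddEmb_apply, Fin.val_castAdd] at this
    have := a.isLt
    omega
  rw [Finset.sum_union hdisj, Finset.sum_map, Finset.sum_map]
  rfl

/-- **Partition coefficients of the `K`-fold determinantal witness**: `[x^U y^W] rename π det(1 + diag X·G)`
is the sum of the principal minors of `G` over the transversals of `U ⊔ W̄`. -/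
theorem coeff_kfoldWitness {N : ℕ} (G : Matrix (Fin N) (Fin N) ℂ) (π : Fin N → Fin (h + h))
    (U W : Finset (Fin h)) :
    MvPolynomial.coeff
        (∑ a ∈ U, Finsupp.single (Fin.castAdd h a) 1 + ∑ c ∈ W, Finsupp.single (Fin.natAdd h c) 1)
        (rename π ((1 + Matrix.diagonal (fun i : Fin N => (X i : MvPolynomial (Fin N) ℂ)) *
          G.map MvPolynomial.C).det)) =
      ∑ R ∈ (Finset.univ : Finset (Fin N)).powerset.filter
        (fun R => R.image π = U.map (Fin.castAddEmb h) ∪ W.map (Fin.natAddEmb h) ∧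
          R.card = (U.map (Fin.castAddEmb h) ∪ W.map (Fin.natAddEmb h)).card),
        (G.submatrix (Subtype.val : ↥R → Fin N) (Subtype.val : ↥R → Fin N)).det := by
  classical
  rw [det_one_add_diagonal_mul, map_sum, coeff_sum, partitionExpo_eq_indicator, Finset.sum_filter,
    Finset.powerset_univ]
  refine Finset.sum_congr rfl fun R _ => ?_
  rw [rename_monomial, coeff_monomial, Finsupp.mapDomain_finsetSum]
  simp_rw [Finsupp.mapDomain_single]
  by_cases hR : R.image π = U.map (Fin.castAddEmb h) ∪ W.map (Fin.natAddEmb h) ∧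
      R.card = (U.map (Fin.castAddEmb h) ∪ W.map (Fin.natAddEmb h)).card
  · rw [if_pos hR, if_pos ((indicatorSum_eq_iff π R _).mpr hR)]
  · rw [if_neg hR, if_neg (fun heq => hR ((indicatorSum_eq_iff π R _).mp heq))]

/-! ## 2. The dead layout -/

/-- **NO-GO for bounded-multiplicity determinantal witnesses.** If `(K|T|)² + 1 < 2^|T| ≤ h + 1` for a
block `T ⊆ Fin h`, one injective layout with `2^|T|` rows (of size `≤ 1`, columns inside `T`) has a
singular layout matrix for EVERY `K`-fold determinantal witness `rename π det(1 + diag X · G)` whose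
labelling carries each label `ȳ_c`, `c ∈ T`, at most `K` times — whatever `N` and `G`. -/
theorem kfoldWitness_dead_layout (K : ℕ) (T : Finset (Fin h))
    (hT : (K * T.card) * (K * T.card) + 1 < 2 ^ T.card) (hh : 2 ^ T.card ≤ h + 1) :
    ∃ u w : Fin (2 ^ T.card) → Finset (Fin h), Function.Injective u ∧ Function.Injective w ∧
      (∀ i, (u i).card ≤ 1) ∧ (∀ j, w j ⊆ T) ∧
      ∀ (N : ℕ) (G : Matrix (Fin N) (Fin N) ℂ) (π : Fin N → Fin (h + h)),
        (∀ c ∈ T, (Finset.univ.filter (fun z : Fin N => π z = Fin.natAdd h c)).card ≤ K) →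
        (Matrix.of fun i j : Fin (2 ^ T.card) => MvPolynomial.coeff
          (∑ a ∈ u i, Finsupp.single (Fin.castAdd h a) 1 +
            ∑ c ∈ w j, Finsupp.single (Fin.natAdd h c) 1)
          (rename π ((1 + Matrix.diagonal (fun i : Fin N => (X i : MvPolynomial (Fin N) ℂ)) *
            G.map MvPolynomial.C).det))).det = 0 := by
  obtain ⟨u, w, hu, hw, hu1, hwT⟩ :=
    exists_injective_layout 1 T (le_trans hh (succ_le_card_filter_card_le_one h))
  refine ⟨u, w, hu, hw, hu1, hwT, fun N G π hK => ?_⟩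
  have hmat : (Matrix.of fun i j : Fin (2 ^ T.card) => MvPolynomial.coeff
        (∑ a ∈ u i, Finsupp.single (Fin.castAdd h a) 1 +
          ∑ c ∈ w j, Finsupp.single (Fin.natAdd h c) 1)
        (rename π ((1 + Matrix.diagonal (fun i : Fin N => (X i : MvPolynomial (Fin N) ℂ)) *
          G.map MvPolynomial.C).det))) =
      Matrix.of fun i j : Fin (2 ^ T.card) =>
        ∑ R ∈ (Finset.univ : Finset (Fin N)).powerset.filter
          (fun R => R.image π = (u i).map (Fin.castAddEmb h) ∪ (w j).map (Fin.natAddEmb h) ∧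
            R.card = ((u i).map (Fin.castAddEmb h) ∪ (w j).map (Fin.natAddEmb h)).card),
          (G.submatrix (Subtype.val : ↥R → Fin N) (Subtype.val : ↥R → Fin N)).det := by
    ext i j
    rw [Matrix.of_apply, Matrix.of_apply, coeff_kfoldWitness]
  rw [hmat]
  exact kfold_det_eq_zero_of_singleton_rows G π T hK u w
    (fun i => eq_empty_or_singleton_of_card_le_one (u i) (hu1 i)) hwT hT

end

end Summit.ValiantsHypothesis.ValiantsHypothesis.Theorems.BarrierLever.KFoldDet
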